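import Mathlib
import Literature.Analysis.FluidPDE.Tao2016AveragedNS.SelfSimilarCascadeResidues
import Literature.Analysis.FluidPDE.Tao2016AveragedNS.BoundedEternalSolutions
import HarnessLib

/-!
# `TransitMassLedger.LedgerRigidity` — energy bookkeeping of the `λ = 1` limit lattice
# (helper file for item stmt-NavierStokesRegularity-24398; `--supports`)

For a cancelling table `α` (Tao 2016 §4 (4.3)) with structure maps `Q = tableQ α`, `A = tableA α`,
`B = tableB α` and a solution `V : ℤ → ℝ → ℝ^m` of the `λ = 1` limit lattice
`V_n' = Q V_n + A V_(n-1) + B(V_(n+1), V_n)` with `‖V_n(s)‖ ≤ 1` and `Σ_n ‖V_n(s)‖² < ∞` at each time,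
this file proves, on COMPACT time intervals only (no improper integrals):

* the shell energy identity `d‖V_n‖²/ds = 2⟪V_n, A V_(n-1)⟫ − 2⟪V_(n+1), A V_n⟫`
  (`hasDerivAt_shellEnergy`, from `⟪x, Qx⟫ = 0` and `⟪y, Ax⟫ + ⟪x, B(y,x)⟫ = 0`);
* the TAIL FLUX IDENTITIES `T_n(s₂) − T_n(s₁) = 2∫_(s₁)^(s₂) ⟪V_(n+1), A V_n⟫` for the energy above
  shell `n`, `T_n = Σ_(k ≥ 0) ‖V_(n+1+k)‖²`, and `B_n(s₂) − B_n(s₁) = −2∫ ⟪V_(n+1), A V_n⟫` for the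
  energy at and below `n`, `B_n = Σ_(k ≥ 0) ‖V_(n−k)‖²` (`tailAbove_sub`, `tailBelow_sub`; finite
  windows + dominated convergence for the escaping boundary flux);
* ENERGY CONSERVATION `Σ_n ‖V_n(s)‖² = const` (`energy_conserved`) and the splitting
  `Σ_n ‖V_n‖² = B_n + T_n` (`tsum_int_eq_tails`), tail monotonicity and finite-window bounds.

HONEST FRAMING: elementary real analysis of a MODEL lattice ODE (Tao 2016 §4, `λ = 1` limit);
nothing here concerns the Navier–Stokes equations.  No item is closed by this file.
-/

noncomputable section

set_option linter.dupNamespace false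

namespace Summit.NavierStokesRegularity.NavierStokesRegularity.Theorems

namespace TransitMassLedgerEnergy

open MeasureTheory Filter Topology Finset intervalIntegral
open scoped RealInnerProductSpace
open Literature.Analysis.FluidPDE Literature.Analysis.FluidPDE.TaoCascade

variable {m : ℕ}

/-! ## Continuity of the structure maps -/

/-- The intra-shell map `Q` of a table is continuous (a quadratic polynomial map).
[cite: Tao2016AveragedNS, §4 (4.1), Lemma 4.1 (4.8); cell dictionary `tableQ`] -/
theorem continuous_tableQ (α : Fin m → Fin m → Fin m → ℤ × ℤ × ℤ → ℝ) : Continuous (tableQ α) := by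
  unfold tableQ qform; fun_prop

/-- The outflow map `A` of a table is continuous.
[cite: Tao2016AveragedNS, §4 (4.1), Lemma 4.1 (4.8); cell dictionary `tableA`] -/
theorem continuous_tableA (α : Fin m → Fin m → Fin m → ℤ × ℤ × ℤ → ℝ) : Continuous (tableA α) := by
  unfold tableA qform; fun_prop

/-- The back-reaction map `B` of a table is continuous along two continuous curves.
[cite: Tao2016AveragedNS, §4 (4.1), Lemma 4.1 (4.8); cell dictionary `tableB`] -/
theorem continuous_tableB_comp (α : Fin m → Fin m → Fin m → ℤ × ℤ × ℤ → ℝ) {f g : ℝ → Em m}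
    (hf : Continuous f) (hg : Continuous g) : Continuous fun s => tableB α (f s) (g s) := by
  unfold tableB qform; fun_prop

/-! ## The shell energy identity -/

/-- A solution of the `λ = 1` lattice is continuous in time, shell by shell. [folklore] -/
theorem continuous_shell {α : Fin m → Fin m → Fin m → ℤ × ℤ × ℤ → ℝ} {V : ℤ → ℝ → Em m}
    (hl : ∀ (n : ℤ) (s : ℝ), HasDerivAt (V n)
      (tableQ α (V n s) + tableA α (V (n - 1) s) + tableB α (V (n + 1) s) (V n s)) s) (n : ℤ) :
    Continuous (V n) :=
  continuous_iff_continuousAt.2 fun s => (hl n s).continuousAt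

/-- **Shell energy identity** of the `λ = 1` lattice of a cancelling table:
`d‖V_n‖²/ds = 2⟪V_n, A V_(n-1)⟫ − 2⟪V_(n+1), A V_n⟫` (influx from below minus outflux above),
from `⟪x, Q x⟫ = 0` and the cancellation `⟪y, A x⟫ + ⟪x, B(y,x)⟫ = 0`.
[cite: Tao2016AveragedNS, §1.2 (energy transfer between consecutive modes), §4 (4.3), Lemma 4.1 (4.9)] -/
theorem hasDerivAt_shellEnergy {α : Fin m → Fin m → Fin m → ℤ × ℤ × ℤ → ℝ} (hc : IsCancellingCoeff α)
    {V : ℤ → ℝ → Em m}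
    (hl : ∀ (n : ℤ) (s : ℝ), HasDerivAt (V n)
      (tableQ α (V n s) + tableA α (V (n - 1) s) + tableB α (V (n + 1) s) (V n s)) s)
    (n : ℤ) (s : ℝ) :
    HasDerivAt (fun s => ‖V n s‖ ^ 2)
      (2 * ⟪V n s, tableA α (V (n - 1) s)⟫ - 2 * ⟪V (n + 1) s, tableA α (V n s)⟫) s := by
  have hS := table_sTable α hc
  have h := (hl n s).norm_sq
  convert h using 1
  rw [inner_add_right, inner_add_right, hS.intra (V n s)]
  have hcancel := hS.cancel (V n s) (V (n + 1) s)
  linarith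

/-! ## Telescoping windows and their time integrals (abstract form) -/

/-- Telescoping FTC: if `e_k' = 2F_k − 2F_(k+1)` with continuous `F_k`, then
`Σ_(k<K) e_k(s₂) − Σ_(k<K) e_k(s₁) = 2∫F_0 − 2∫F_K` on `[s₁, s₂]`. [folklore] -/
theorem sum_sub_sum_eq_integral {e F : ℕ → ℝ → ℝ}
    (he : ∀ (k : ℕ) (s : ℝ), HasDerivAt (e k) (2 * F k s - 2 * F (k + 1) s) s)
    (hF : ∀ k, Continuous (F k)) (K : ℕ) (s₁ s₂ : ℝ) :
    (∑ k ∈ range K, e k s₂) - ∑ k ∈ range K, e k s₁ =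
      2 * (∫ s in s₁..s₂, F 0 s) - 2 * ∫ s in s₁..s₂, F K s := by
  have hderiv : ∀ s, HasDerivAt (fun s => ∑ k ∈ range K, e k s) (2 * F 0 s - 2 * F K s) s := by
    intro s
    have h := HasDerivAt.fun_sum (u := range K) (fun k _ => he k s)
    rwa [Finset.sum_range_sub' (fun k => 2 * F k s)] at h
  have hint : IntervalIntegrable (fun s => 2 * F 0 s - 2 * F K s) volume s₁ s₂ :=
    ((continuous_const.mul (hF 0)).sub (continuous_const.mul (hF K))).intervalIntegrable _ _
  rw [← intervalIntegral.integral_const_mul, ← intervalIntegral.integral_const_mul,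
    ← intervalIntegral.integral_sub (((hF 0).intervalIntegrable _ _).const_mul 2)
      (((hF K).intervalIntegrable _ _).const_mul 2)]
  exact (integral_eq_sub_of_hasDerivAt (fun s _ => hderiv s) hint).symm

/-- Dominated convergence on a compact time interval for a uniformly bounded sequence of continuous
functions tending to zero pointwise. [folklore] -/
theorem tendsto_intervalIntegral_zero {F : ℕ → ℝ → ℝ} (hF : ∀ k, Continuous (F k)) {C : ℝ}
    (hbd : ∀ k s, |F k s| ≤ C) (hlim : ∀ s, Tendsto (fun k => F k s) atTop (𝓝 0)) (s₁ s₂ : ℝ) :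
    Tendsto (fun k => ∫ s in s₁..s₂, F k s) atTop (𝓝 0) := by
  have h := intervalIntegral.tendsto_integral_filter_of_dominated_convergence (μ := volume)
    (a := s₁) (b := s₂) (f := fun _ => (0 : ℝ)) (F := F) (l := atTop) (fun _ => C)
    (Eventually.of_forall fun k => (hF k).aestronglyMeasurable)
    (Eventually.of_forall fun k => ae_of_all _ fun s _ => by
      rw [Real.norm_eq_abs]; exact hbd k s)
    intervalIntegrable_const
    (ae_of_all _ fun s _ => hlim s)
  simpa using h

/-- Passing to the limit in the telescoping identity: if moreover `Σ_k e_k(s)` converges at each time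
and the escaping flux `∫F_K → 0`, then `Σ_k e_k(s₂) − Σ_k e_k(s₁) = 2∫_(s₁)^(s₂) F_0`. [folklore] -/
theorem tsum_sub_tsum_eq_integral {e F : ℕ → ℝ → ℝ}
    (he : ∀ (k : ℕ) (s : ℝ), HasDerivAt (e k) (2 * F k s - 2 * F (k + 1) s) s)
    (hF : ∀ k, Continuous (F k)) (hsum : ∀ s, Summable fun k => e k s) {s₁ s₂ : ℝ}
    (hlim : Tendsto (fun K => ∫ s in s₁..s₂, F K s) atTop (𝓝 0)) :
    (∑' k, e k s₂) - ∑' k, e k s₁ = 2 * ∫ s in s₁..s₂, F 0 s := by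
  have h1 : Tendsto (fun K => (∑ k ∈ range K, e k s₂) - ∑ k ∈ range K, e k s₁) atTop
      (𝓝 ((∑' k, e k s₂) - ∑' k, e k s₁)) :=
    (hsum s₂).hasSum.tendsto_sum_nat.sub (hsum s₁).hasSum.tendsto_sum_nat
  have h2 : Tendsto (fun K => (∑ k ∈ range K, e k s₂) - ∑ k ∈ range K, e k s₁) atTop
      (𝓝 (2 * (∫ s in s₁..s₂, F 0 s) - 2 * 0)) := by
    have : (fun K => (∑ k ∈ range K, e k s₂) - ∑ k ∈ range K, e k s₁) =
        fun K => 2 * (∫ s in s₁..s₂, F 0 s) - 2 * ∫ s in s₁..s₂, F K s :=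
      funext fun K => sum_sub_sum_eq_integral he hF K s₁ s₂
    rw [this]
    exact tendsto_const_nhds.sub (hlim.const_mul 2)
  have h := tendsto_nhds_unique h1 h2
  rw [mul_zero, sub_zero] at h
  exact h

/-! ## The tail flux identities of the `λ = 1` lattice -/

section Lattice

variable {α : Fin m → Fin m → Fin m → ℤ × ℤ × ℤ → ℝ} {V : ℤ → ℝ → Em m}

/-- The flux `⟪V_(k+1), A V_k⟫` is bounded by `C_A ‖V_k‖²` along a solution of the unit ball.
[cite: Tao2016AveragedNS, §4 (4.1), Lemma 4.1 (4.9); cell lemma `norm_tableA_le`] -/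
theorem abs_flux_le (hb : ∀ (n : ℤ) (s : ℝ), ‖V n s‖ ≤ 1) (j k : ℤ) (s : ℝ) :
    |⟪V j s, tableA α (V k s)⟫| ≤ shiftConst α (0, 0, 1) * ‖V k s‖ ^ 2 := by
  calc |⟪V j s, tableA α (V k s)⟫| ≤ ‖V j s‖ * ‖tableA α (V k s)‖ := abs_real_inner_le_norm _ _
    _ ≤ 1 * (shiftConst α (0, 0, 1) * ‖V k s‖ ^ 2) :=
        mul_le_mul (hb j s) (norm_tableA_le α (V k s)) (norm_nonneg _) zero_le_one
    _ = shiftConst α (0, 0, 1) * ‖V k s‖ ^ 2 := one_mul _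

/-- Along a solution of the unit ball, `‖V_k‖² ≤ 1`. [folklore] -/
theorem norm_sq_le_one (hb : ∀ (n : ℤ) (s : ℝ), ‖V n s‖ ≤ 1) (k : ℤ) (s : ℝ) : ‖V k s‖ ^ 2 ≤ 1 := by
  have h0 := norm_nonneg (V k s)
  have h1 := hb k s
  nlinarith

/-- The shifted families `k ↦ ‖V_(n+k)(s)‖²` (`k ∈ ℕ`) are summable when `Σ_(j ∈ ℤ) ‖V_j(s)‖²` is. [folklore] -/
theorem summable_shift_nat (hs : ∀ s : ℝ, Summable fun n : ℤ => ‖V n s‖ ^ 2) (n : ℤ) (s : ℝ) :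
    Summable fun k : ℕ => ‖V (n + k) s‖ ^ 2 := by
  have h := (hs s).comp_injective (i := fun k : ℕ => n + (k : ℤ))
    (fun a b hab => by simpa using hab)
  exact h

/-- The reflected families `k ↦ ‖V_(n−k)(s)‖²` (`k ∈ ℕ`) are summable when `Σ_(j ∈ ℤ) ‖V_j(s)‖²` is. [folklore] -/
theorem summable_reflect_nat (hs : ∀ s : ℝ, Summable fun n : ℤ => ‖V n s‖ ^ 2) (n : ℤ) (s : ℝ) :
    Summable fun k : ℕ => ‖V (n - k) s‖ ^ 2 := by
  have h := (hs s).comp_injective (i := fun k : ℕ => n - (k : ℤ))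
    (fun a b hab => by simpa using hab)
  exact h

/-- **Tail flux identity, upward**: the energy strictly above shell `n`,
`T_n(s) = Σ_(k ≥ 0) ‖V_(n+1+k)(s)‖²`, changes exactly by twice the time-integrated outflux of shell `n`:
`T_n(s₂) − T_n(s₁) = 2 ∫_(s₁)^(s₂) ⟪V_(n+1), A V_n⟫`.  (Finite windows telescope; the boundary flux at
the top of the window tends to zero by dominated convergence since `‖V_K(s)‖ → 0` as `K → ∞`.)
[cite: Tao2016AveragedNS, §1.2, §4 Lemma 4.1 (4.9) (local energy balance); this file (the `λ = 1` lattice)] -/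
theorem tailAbove_sub (hc : IsCancellingCoeff α)
    (hl : ∀ (n : ℤ) (s : ℝ), HasDerivAt (V n)
      (tableQ α (V n s) + tableA α (V (n - 1) s) + tableB α (V (n + 1) s) (V n s)) s)
    (hb : ∀ (n : ℤ) (s : ℝ), ‖V n s‖ ≤ 1) (hs : ∀ s : ℝ, Summable fun n : ℤ => ‖V n s‖ ^ 2)
    (n : ℤ) (s₁ s₂ : ℝ) :
    (∑' k : ℕ, ‖V (n + 1 + k) s₂‖ ^ 2) - (∑' k : ℕ, ‖V (n + 1 + k) s₁‖ ^ 2) =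
      2 * ∫ s in s₁..s₂, ⟪V (n + 1) s, tableA α (V n s)⟫ := by
  have hV := continuous_shell hl
  have hA := continuous_tableA α
  -- e k s := ‖V (n+1+k) s‖², F k s := ⟪V (n+1+k) s, A (V (n+k) s)⟫
  have he : ∀ (k : ℕ) (s : ℝ), HasDerivAt (fun s => ‖V (n + 1 + k) s‖ ^ 2)
      (2 * ⟪V (n + 1 + k) s, tableA α (V (n + k) s)⟫
        - 2 * ⟪V (n + 1 + (k + 1 : ℕ)) s, tableA α (V (n + (k + 1 : ℕ)) s)⟫) s := by
    intro k s
    have h := hasDerivAt_shellEnergy hc hl (n + 1 + k) s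
    have e1 : n + 1 + (k : ℤ) - 1 = n + k := by ring
    have e2 : n + 1 + (k : ℤ) + 1 = n + 1 + ((k + 1 : ℕ) : ℤ) := by push_cast; ring
    have e3 : n + ((k + 1 : ℕ) : ℤ) = n + 1 + k := by push_cast; ring
    rw [e1, e2] at h
    rw [e3]
    exact h
  have hF : ∀ k : ℕ, Continuous fun s => ⟪V (n + 1 + k) s, tableA α (V (n + k) s)⟫ :=
    fun k => (hV _).inner (hA.comp (hV _))
  have hsum : ∀ s, Summable fun k : ℕ => ‖V (n + 1 + k) s‖ ^ 2 :=
    fun s => summable_shift_nat hs (n + 1) s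
  have hlim : Tendsto (fun K : ℕ => ∫ s in s₁..s₂, ⟪V (n + 1 + K) s, tableA α (V (n + K) s)⟫)
      atTop (𝓝 0) := by
    refine tendsto_intervalIntegral_zero hF (C := shiftConst α (0, 0, 1)) (fun K s => ?_)
      (fun s => ?_) s₁ s₂
    · exact (abs_flux_le hb _ _ s).trans (by
        have := norm_sq_le_one hb (n + K) s
        have h0 := shiftConst_nonneg α (0, 0, 1)
        nlinarith)
    · have h0 : Tendsto (fun K : ℕ => shiftConst α (0, 0, 1) * ‖V (n + K) s‖ ^ 2) atTop (𝓝 0) := by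
        have := (summable_shift_nat hs n s).tendsto_atTop_zero.const_mul (shiftConst α (0, 0, 1))
        simpa using this
      exact squeeze_zero_norm (fun K => by
        rw [Real.norm_eq_abs]; exact abs_flux_le hb _ _ s) h0
  have h := tsum_sub_tsum_eq_integral he hF hsum hlim
  simpa using h

/-- **Tail flux identity, downward**: the energy at and below shell `n`,
`B_n(s) = Σ_(k ≥ 0) ‖V_(n−k)(s)‖²`, changes by minus twice the time-integrated outflux of shell `n`:
`B_n(s₂) − B_n(s₁) = −2 ∫_(s₁)^(s₂) ⟪V_(n+1), A V_n⟫`.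
[cite: Tao2016AveragedNS, §1.2, §4 Lemma 4.1 (4.9); this file (the `λ = 1` lattice)] -/
theorem tailBelow_sub (hc : IsCancellingCoeff α)
    (hl : ∀ (n : ℤ) (s : ℝ), HasDerivAt (V n)
      (tableQ α (V n s) + tableA α (V (n - 1) s) + tableB α (V (n + 1) s) (V n s)) s)
    (hb : ∀ (n : ℤ) (s : ℝ), ‖V n s‖ ≤ 1) (hs : ∀ s : ℝ, Summable fun n : ℤ => ‖V n s‖ ^ 2)
    (n : ℤ) (s₁ s₂ : ℝ) :
    (∑' k : ℕ, ‖V (n - k) s₂‖ ^ 2) - (∑' k : ℕ, ‖V (n - k) s₁‖ ^ 2) =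
      -(2 * ∫ s in s₁..s₂, ⟪V (n + 1) s, tableA α (V n s)⟫) := by
  have hV := continuous_shell hl
  have hA := continuous_tableA α
  -- e k s := ‖V (n-k) s‖², F k s := -⟪V (n-k+1) s, A (V (n-k) s)⟫
  have he : ∀ (k : ℕ) (s : ℝ), HasDerivAt (fun s => ‖V (n - k) s‖ ^ 2)
      (2 * (-⟪V (n - k + 1) s, tableA α (V (n - k) s)⟫)
        - 2 * (-⟪V (n - (k + 1 : ℕ) + 1) s, tableA α (V (n - (k + 1 : ℕ)) s)⟫)) s := by
    intro k s
    have h := hasDerivAt_shellEnergy hc hl (n - k) s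
    have e1 : n - ((k + 1 : ℕ) : ℤ) + 1 = n - k := by push_cast; ring
    have e2 : n - ((k + 1 : ℕ) : ℤ) = n - k - 1 := by push_cast; ring
    rw [e1, e2]
    convert h using 1
    ring
  have hF : ∀ k : ℕ, Continuous fun s => -⟪V (n - k + 1) s, tableA α (V (n - k) s)⟫ :=
    fun k => ((hV _).inner (hA.comp (hV _))).neg
  have hsum : ∀ s, Summable fun k : ℕ => ‖V (n - k) s‖ ^ 2 := fun s => summable_reflect_nat hs n s
  have hlim : Tendsto (fun K : ℕ => ∫ s in s₁..s₂, -⟪V (n - K + 1) s, tableA α (V (n - K) s)⟫)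
      atTop (𝓝 0) := by
    refine tendsto_intervalIntegral_zero hF (C := shiftConst α (0, 0, 1)) (fun K s => ?_)
      (fun s => ?_) s₁ s₂
    · rw [abs_neg]
      exact (abs_flux_le hb _ _ s).trans (by
        have := norm_sq_le_one hb (n - K) s
        have h0 := shiftConst_nonneg α (0, 0, 1)
        nlinarith)
    · have h0 : Tendsto (fun K : ℕ => shiftConst α (0, 0, 1) * ‖V (n - K) s‖ ^ 2) atTop (𝓝 0) := by
        have := (summable_reflect_nat hs n s).tendsto_atTop_zero.const_mul (shiftConst α (0, 0, 1))
        simpa using this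
      exact squeeze_zero_norm (fun K => by
        rw [Real.norm_eq_abs, abs_neg]; exact abs_flux_le hb _ _ s) h0
  have h := tsum_sub_tsum_eq_integral he hF hsum hlim
  simp only [CharP.cast_eq_zero, sub_zero] at h
  rw [h, intervalIntegral.integral_neg, mul_neg]

/-- **Splitting of the total energy at a shell**: `Σ_(j ∈ ℤ) ‖V_j‖² = B_n + T_n`.
[folklore (re-indexing an absolutely convergent series over `ℤ`)] -/
theorem tsum_int_eq_tails (hs : ∀ s : ℝ, Summable fun n : ℤ => ‖V n s‖ ^ 2) (n : ℤ) (s : ℝ) :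
    ∑' j : ℤ, ‖V j s‖ ^ 2 = (∑' k : ℕ, ‖V (n - k) s‖ ^ 2) + ∑' k : ℕ, ‖V (n + 1 + k) s‖ ^ 2 := by
  have h1 : HasSum (fun k : ℕ => ‖V (n + 1 + k) s‖ ^ 2) (∑' k : ℕ, ‖V (n + 1 + k) s‖ ^ 2) :=
    (summable_shift_nat hs (n + 1) s).hasSum
  have h2 : HasSum (fun k : ℕ => ‖V (n - k) s‖ ^ 2) (∑' k : ℕ, ‖V (n - k) s‖ ^ 2) :=
    (summable_reflect_nat hs n s).hasSum
  -- g j := ‖V (j + (n+1)) s‖², summed over ℤ via its natural and negative parts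
  have hg : HasSum (fun j : ℤ => ‖V (j + (n + 1)) s‖ ^ 2)
      ((∑' k : ℕ, ‖V (n + 1 + k) s‖ ^ 2) + ∑' k : ℕ, ‖V (n - k) s‖ ^ 2) := by
    refine HasSum.of_nat_of_neg_add_one ?_ ?_
    · convert h1 using 2 with k
      rw [add_comm]
    · convert h2 using 2 with k
      congr 2
      ring
  have hg' : HasSum (fun j : ℤ => ‖V j s‖ ^ 2)
      ((∑' k : ℕ, ‖V (n + 1 + k) s‖ ^ 2) + ∑' k : ℕ, ‖V (n - k) s‖ ^ 2) :=
    (Equiv.addRight (n + 1)).hasSum_iff.mp hg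
  rw [hg'.tsum_eq, add_comm]

/-- **Energy conservation** for the `λ = 1` lattice of a cancelling table (solutions of the unit ball
with square-summable slices): `Σ_(j ∈ ℤ) ‖V_j(s)‖²` does not depend on `s`.
[cite: Tao2016AveragedNS, §4 (4.3) (cancellation ⇒ energy identity), Lemma 4.1 (4.9); this file] -/
theorem energy_conserved (hc : IsCancellingCoeff α)
    (hl : ∀ (n : ℤ) (s : ℝ), HasDerivAt (V n)
      (tableQ α (V n s) + tableA α (V (n - 1) s) + tableB α (V (n + 1) s) (V n s)) s)
    (hb : ∀ (n : ℤ) (s : ℝ), ‖V n s‖ ≤ 1) (hs : ∀ s : ℝ, Summable fun n : ℤ => ‖V n s‖ ^ 2)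
    (s₁ s₂ : ℝ) : ∑' j : ℤ, ‖V j s₂‖ ^ 2 = ∑' j : ℤ, ‖V j s₁‖ ^ 2 := by
  rw [tsum_int_eq_tails hs 0 s₂, tsum_int_eq_tails hs 0 s₁]
  have h1 := tailAbove_sub hc hl hb hs 0 s₁ s₂
  have h2 := tailBelow_sub hc hl hb hs 0 s₁ s₂
  linarith

/-- A finite window of shells carries at most the total energy. [folklore] -/
theorem sum_window_le_tsum (hs : ∀ s : ℝ, Summable fun n : ℤ => ‖V n s‖ ^ 2) (S : Finset ℤ)
    (s : ℝ) : ∑ j ∈ S, ‖V j s‖ ^ 2 ≤ ∑' j : ℤ, ‖V j s‖ ^ 2 :=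
  (hs s).sum_le_tsum S fun _ _ => sq_nonneg _

/-- One shell carries at most the total energy. [folklore] -/
theorem shell_le_tsum (hs : ∀ s : ℝ, Summable fun n : ℤ => ‖V n s‖ ^ 2) (j : ℤ) (s : ℝ) :
    ‖V j s‖ ^ 2 ≤ ∑' j : ℤ, ‖V j s‖ ^ 2 := by
  simpa using sum_window_le_tsum hs {j} s

/-- A finite window above shell `n` carries at most the energy above shell `n`:
`Σ_(j<r) ‖V_(n+1+j)‖² ≤ T_n`. [folklore] -/
theorem sum_range_le_tailAbove (hs : ∀ s : ℝ, Summable fun n : ℤ => ‖V n s‖ ^ 2) (n : ℤ) (r : ℕ)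
    (s : ℝ) : ∑ j ∈ range r, ‖V (n + 1 + j) s‖ ^ 2 ≤ ∑' k : ℕ, ‖V (n + 1 + k) s‖ ^ 2 :=
  (summable_shift_nat hs (n + 1) s).sum_le_tsum (range r) fun _ _ => sq_nonneg _

/-- The tails are non-negative. [folklore] -/
theorem tailAbove_nonneg (n : ℤ) (s : ℝ) : 0 ≤ ∑' k : ℕ, ‖V (n + 1 + k) s‖ ^ 2 :=
  tsum_nonneg fun _ => sq_nonneg _

/-- The tails are non-negative. [folklore] -/
theorem tailBelow_nonneg (n : ℤ) (s : ℝ) : 0 ≤ ∑' k : ℕ, ‖V (n - k) s‖ ^ 2 :=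
  tsum_nonneg fun _ => sq_nonneg _

/-- **Tail monotonicity**: the energy above shell `n + d` is at most the energy above shell `n`
(`T_n = Σ_(i<d) ‖V_(n+1+i)‖² + T_(n+d)`). [folklore] -/
theorem tailAbove_add_le (hs : ∀ s : ℝ, Summable fun n : ℤ => ‖V n s‖ ^ 2) (n : ℤ) (d : ℕ)
    (s : ℝ) : ∑' k : ℕ, ‖V (n + d + 1 + k) s‖ ^ 2 ≤ ∑' k : ℕ, ‖V (n + 1 + k) s‖ ^ 2 := by
  have h := (summable_shift_nat hs (n + 1) s).sum_add_tsum_nat_add d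
  -- h : (∑ i ∈ range d, ‖V (n+1+i)‖²) + ∑' i, ‖V (n+1+(i+d))‖² = ∑' i, ‖V (n+1+i)‖²
  have e : (fun i : ℕ => ‖V (n + 1 + ((i + d : ℕ) : ℤ)) s‖ ^ 2) =
      fun i : ℕ => ‖V (n + d + 1 + i) s‖ ^ 2 := by
    funext i; congr 3; push_cast; ring
  rw [e] at h
  have h0 : 0 ≤ ∑ i ∈ range d, ‖V (n + 1 + (i : ℤ)) s‖ ^ 2 := Finset.sum_nonneg fun _ _ => sq_nonneg _
  linarith

end Lattice

end TransitMassLedgerEnergy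

end Summit.NavierStokesRegularity.NavierStokesRegularity.Theorems

end
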